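import Mathlib
import HarnessLib
import Summits.Ventures.LatticeQCDFlow.Scaling.MorseStructureNonAbelian

/-!
# LatticeQCDFlow / Scaling — along the optimal Morse structure the UNCOVERED WEIGHT `F_R` is not a function of
# the covered holonomies when the weight separates a commutator from `1` (non-abelian Wilson weights)

HONEST FRAMING: exact (Metropolis-corrected) sampling algorithms for lattice gauge theory;
figures of merit are autocorrelation/cost numbers at stated couplings and volumes; no
continuum-physics claim.

Venture `LatticeQCDFlow` (cell pub-lqcd), topic `Scaling`, FANOUT row 30 (lean-1, GEN-28) — OUR WORK on
THEORY-2.md §4 row C5.  `AbelianHolonomyDetermination.prod_weight_eq_of_covered_eq`: for a COMMUTATIVE gauge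
group, along a full ranked structure the uncovered weight product `F_R(U) = ∏_{p∉B} w(U_p)` — the exact
sampler's importance weight up to constants — is a function of the covered holonomies: the exact one-plaquette
heat-bath autoregression leaves nothing random in the target.  `MorseStructureNonAbelian`: along the optimal
Morse structure a non-commuting pair leaves a plaquette's holonomy (even its conjugacy class) free.  Here the
sampler-facing form:

* **`morse_uncoveredWeight_lt`** — `d ≥ 2`; `w ≤ M = w(1)` with `w([a,b]) < M` for some pair `a, b` (e.g. the
  Wilson weight `exp(β Re tr)` on `SU(N)`, maximal exactly at `1`): the trivial configuration and the two-seam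
  configuration through `(−1, −1)` have the SAME holonomy around every covered plaquette of the Morse structure
  and uncovered weights `F_R(V) < F_R(U) = M^k`;
* **`morse_uncoveredWeight_not_determined`** — hence `F_R` is NOT a function of the covered holonomies: for a
  non-abelian Wilson-type weight the target keeps genuinely random mass outside EVERY optimal exact
  one-plaquette heat-bath autoregression built on the Morse structure — the converse of the abelian
  `prod_weight_eq_of_covered_eq`.

No `def`, no `sorry`, nothing cited as a fact beyond the tree.
-/

namespace Summit.Ventures.LatticeQCDFlow.Theory2.Autoregressive

open Finset
open Literature.MathematicalPhysics.QuantumFieldTheory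

variable {d L : ℕ} [NeZero L] {G : Type*} [Group G]

/-- **ALONG THE MORSE STRUCTURE THE UNCOVERED WEIGHT DROPS ON THE TWO-SEAM CONFIGURATION WHILE THE COVERED
HOLONOMIES DO NOT MOVE** (`d ≥ 2`; `0 < w ≤ M = w(1)`, `w(a b a⁻¹ b⁻¹) < M`). [ours] -/
theorem morse_uncoveredWeight_lt (hd : 2 ≤ d) {w : G → ℝ} {M : ℝ} (hw0 : ∀ g, 0 < w g) (hM : ∀ g, w g ≤ M)
    (hw1 : w 1 = M) {a b : G} (hab : w (a * b * a⁻¹ * b⁻¹) < M)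
    (B : Finset (Plaquette d L))
    (hB : B = Finset.univ.filter (fun p : Plaquette d L =>
      (∀ m : Fin d, m < p.2.1.1 → p.1 m = 0) ∧
        (p.1 p.2.1.1 ≠ -1 ∨ ((∀ m : Fin d, p.2.1.1 < m → m < p.2.1.2 → p.1 m = 0) ∧ p.1 p.2.1.2 ≠ -1)))) :
    ∃ U V : GaugeConfig d L G,
      (∀ p ∈ B, plaquetteHolonomy U p.1 p.2.1.1 p.2.1.2 = plaquetteHolonomy V p.1 p.2.1.1 p.2.1.2) ∧
      ∏ p ∈ Finset.univ \ B, w (plaquetteHolonomy V p.1 p.2.1.1 p.2.1.2) <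
        ∏ p ∈ Finset.univ \ B, w (plaquetteHolonomy U p.1 p.2.1.1 p.2.1.2) ∧
      ∏ p ∈ Finset.univ \ B, w (plaquetteHolonomy U p.1 p.2.1.1 p.2.1.2) = M ^ (Finset.univ \ B).card := by
  classical
  -- a non-commuting pair: `w([a,b]) < M = w(1)` forces `[a,b] ≠ 1`
  have hab' : a * b ≠ b * a := by
    intro h
    have h1 : a * b * a⁻¹ * b⁻¹ = 1 := (mul_mul_inv_mul_inv_eq_one_iff a b).2 h
    rw [h1, hw1] at hab
    exact lt_irrefl _ hab
  set i0 : Fin d := ⟨0, by omega⟩ with hi0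
  set i1 : Fin d := ⟨1, by omega⟩ with hi1
  have h01 : i0 < i1 := by rw [hi0, hi1, Fin.lt_def]; norm_num
  set p₀ : Plaquette d L := (fun _ => (-1 : ZMod L), ⟨(i0, i1), h01⟩) with hp₀
  have hstack : p₀.2.1.1 = i0 ∧ p₀.2.1.2 = i1 ∧ p₀.1 i0 = -1 ∧ p₀.1 i1 = -1 := ⟨rfl, rfl, rfl, rfl⟩
  have hdis := morse_disjoint_stack B hB i0 i1
  have hp₀B : p₀ ∈ Finset.univ \ B := Finset.mem_sdiff.2 ⟨Finset.mem_univ _, fun h => hdis p₀ h hstack⟩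
  -- the two configurations: trivial and two-seam
  set U : GaugeConfig d L G := fun _ => 1 with hU
  set V : GaugeConfig d L G := fun e : Edge d L =>
    if e.2 = i0 then (if e.1 i0 = (-1 : ZMod L) then a else 1)
    else if e.2 = i1 then (if e.1 i1 = (-1 : ZMod L) then b else 1) else 1 with hV
  have hUflat : ∀ p : Plaquette d L, plaquetteHolonomy U p.1 p.2.1.1 p.2.1.2 = 1 := fun p =>
    plaquetteHolonomy_one_config_group p
  have hV_eq : ∀ p : Plaquette d L, plaquetteHolonomy V p.1 p.2.1.1 p.2.1.2 =
      if p.2.1.1 = i0 ∧ p.2.1.2 = i1 ∧ p.1 i0 = -1 ∧ p.1 i1 = -1 then a * b * a⁻¹ * b⁻¹ else 1 := fun p =>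
    plaquetteHolonomy_twoSeam a b h01 (-1) (-1) p
  have hUprod : ∏ p ∈ Finset.univ \ B, w (plaquetteHolonomy U p.1 p.2.1.1 p.2.1.2) = M ^ (Finset.univ \ B).card := by
    rw [Finset.prod_congr rfl fun p _ => by rw [hUflat p, hw1], Finset.prod_const]
  refine ⟨U, V, fun p hp => ?_, ?_, hUprod⟩
  · rw [hUflat p, hV_eq p, if_neg (hdis p hp)]
  · rw [hUprod, ← Finset.mul_prod_erase _ _ hp₀B, hV_eq p₀, if_pos hstack]
    have hrest : ∏ p ∈ (Finset.univ \ B).erase p₀, w (plaquetteHolonomy V p.1 p.2.1.1 p.2.1.2) ≤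
        M ^ ((Finset.univ \ B).erase p₀).card := by
      rw [← Finset.prod_const]
      exact Finset.prod_le_prod (fun p _ => (hw0 _).le) fun p _ => hM _
    have hMpos : 0 < M := (hw0 1).trans_le (hM 1)
    have hcard : (Finset.univ \ B).card = ((Finset.univ \ B).erase p₀).card + 1 := by
      rw [Finset.card_erase_of_mem hp₀B, Nat.sub_add_cancel (Finset.card_pos.2 ⟨p₀, hp₀B⟩)]
    rw [hcard, pow_succ, mul_comm (M ^ _)]
    exact mul_lt_mul hab hrest (Finset.prod_pos fun p _ => hw0 _) hMpos.le

/-- **HENCE `F_R` IS NOT A FUNCTION OF THE COVERED HOLONOMIES ALONG THE MORSE STRUCTURE** for such a weight —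
the converse of the abelian `AbelianHolonomyDetermination.prod_weight_eq_of_covered_eq`. [ours] -/
theorem morse_uncoveredWeight_not_determined (hd : 2 ≤ d) {w : G → ℝ} {M : ℝ} (hw0 : ∀ g, 0 < w g)
    (hM : ∀ g, w g ≤ M) (hw1 : w 1 = M) {a b : G} (hab : w (a * b * a⁻¹ * b⁻¹) < M)
    (B : Finset (Plaquette d L))
    (hB : B = Finset.univ.filter (fun p : Plaquette d L =>
      (∀ m : Fin d, m < p.2.1.1 → p.1 m = 0) ∧
        (p.1 p.2.1.1 ≠ -1 ∨ ((∀ m : Fin d, p.2.1.1 < m → m < p.2.1.2 → p.1 m = 0) ∧ p.1 p.2.1.2 ≠ -1)))) :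
    ¬ ∀ U V : GaugeConfig d L G,
        (∀ p ∈ B, plaquetteHolonomy U p.1 p.2.1.1 p.2.1.2 = plaquetteHolonomy V p.1 p.2.1.1 p.2.1.2) →
        ∏ p ∈ Finset.univ \ B, w (plaquetteHolonomy U p.1 p.2.1.1 p.2.1.2) =
          ∏ p ∈ Finset.univ \ B, w (plaquetteHolonomy V p.1 p.2.1.1 p.2.1.2) := by
  intro h
  obtain ⟨U, V, hcov, hlt, -⟩ := morse_uncoveredWeight_lt (L := L) hd hw0 hM hw1 hab B hB
  exact (ne_of_lt hlt) (h U V hcov).symm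

end Summit.Ventures.LatticeQCDFlow.Theory2.Autoregressive
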